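import Summits.Ventures.Crystal3D.Theorems.StickyWulffConstantGenericWallFloorGeneralLedger
import Summits.Ventures.Crystal3D.Theorems.StickyWulffConstantGenericWallFloorExitsPay
import Summits.Ventures.Crystal3D.Theorems.StickyWulffConstantGenericWallFloorExitCountWindow
import Summits.Ventures.Crystal3D.Theorems.StickyWulffConstantGenericWallFloorRigidRung
import HarnessLib

/-!
# The general-filling rung of `stub_twoSlabAdhesion`: the wall floor for EVERY filling, modulo the twin-capped exits

HONEST FRAMING. Part of the venture `Summits/Ventures/Crystal3D` (cell `crystal3d-full`), helper for the
crux `GenericWallFloor` (stmt-Ventures-19480) of `route-Ventures-StickyWulffConstant`, REGISTERED line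
`WallLedgerG` (planner cf-p1 gen 16), stub `stub_twoSlabAdhesion : TwoSlabAdhesion` (THE CRUX of the line).
CAPSTONE of this seat's general-filling bricks (`…SaturationStructure`, `…ExitTwinCap`, `…ExitTrichotomy`,
`…ExitCount(Window)`, `…ExitsPay`, `…TopCredits`, `…ExitLocation`, `…PayerLocation`, `…GeneralLedger`).
Rung credit only; F-C1 not moved.

**Theorem (`general_twoSlabAdhesion_modulo_twinCaps`).**  Inputs BY NAME: `KissingGap δ`,
`KissingClassification δ` (tree theorems at `δ = 5/2`).  For every pair of moved fcc lattices whose slot sets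
differ (`¬ ∀ w, A₁ w ∈ A₂·Λ₀` and `¬ ∀ w, A₂ w ∈ A₁·Λ₀` — implied by non-co-axiality), every steep up-slot
`u₁` of grain 1 and steep down-slot `u₂` of grain 2, there are `C` and `R₀ = 10` such that in EVERY cell of
`TwoSlabAdhesion` (no rigidity, ARBITRARY filling; clean outer slivers):

  `cross(P₁, X∖P₁) + cross(P₂, Y) ≤ D(Y) + (φ₁ + φ₂ − 1/3770) π ρ² + (#TC₁ + #TC₂)/7540 + C (1 + h) ρ`,

where `TCᵢ` is the set of TWIN-CAPPED EXITS of grain `i` (balls `e` with a full-shell predecessor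
`e − Aᵢ uᵢ`, a missing slot, and the exact twin-cap structure of `exit_twinCap_of_patch`).  So the stub's
inequality holds for general fillings with charge `1/3770` instead of `1`, UP TO the twin-capped exits —
the one residual the monotone-lines bookkeeping (memo GENERAL-FILLING-ARCH) has to control; for fillings
without coherent twin caps on either grain (e.g. every rigid filling of a non-co-axial pair) it is a wall law
outright.  Assembly: `2 D(X) = Σ (12 − deg) ≥ 2(φ₁+φ₂)πρ² + #payers − C(1+h)ρ`
(`ledger_ge_faces_add_payers`), `#payers ≥ (#EX₁ − #TC₁ + #EX₂ − #TC₂)/3770` (`card_exits_le` twice),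
`#EXᵢ ≥ π(ρ−1)² − 10√2π(ρ−1)` (`card_exits_ge`, `card_exits_ge_window`, steep slots), and the stub algebra of
`rigid_twoSlabAdhesion` (`contactDeficiency_sdiff_split`, `affineSampleDeficit_upper`).

WHAT THIS IS NOT: not the stub (`c₀ = 1/3770 ≪ 1`, residual `#TC`, clean slivers assumed); F-C1 not moved.
-/

noncomputable section

namespace Summit.Ventures.Crystal3D.Theorems

open Summit.Ventures.Crystal3D Finset
open Literature.MathematicalPhysics.StatisticalMechanics (fccStacking contactDeficiency)
open scoped InnerProductSpace

open scoped Classical in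
/-- **The general-filling rung modulo twin caps.**  See the module docstring. -/
theorem general_twoSlabAdhesion_modulo_twinCaps {δ : ℝ} (hg : KissingGap δ) (hc : KissingClassification δ)
    (A₁ : EuclideanSpace ℝ (Fin 3) ≃ₗᵢ[ℝ] EuclideanSpace ℝ (Fin 3)) (t₁ : EuclideanSpace ℝ (Fin 3))
    (A₂ : EuclideanSpace ℝ (Fin 3) ≃ₗᵢ[ℝ] EuclideanSpace ℝ (Fin 3)) (t₂ : EuclideanSpace ℝ (Fin 3))
    (hA₁₂ : ¬ ∀ w ∈ fccSlots, A₁ w ∈ A₂ '' fccStacking 1 (Real.sqrt (2 / 3)))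
    (hA₂₁ : ¬ ∀ w ∈ fccSlots, A₂ w ∈ A₁ '' fccStacking 1 (Real.sqrt (2 / 3)))
    {u₁ : EuclideanSpace ℝ (Fin 3)} (hu₁ : u₁ ∈ fccSlots)
    (hsteep₁ : Real.sqrt 2 / 2 ≤ ⟪A₁ u₁, EuclideanSpace.single (2 : Fin 3) (1 : ℝ)⟫_ℝ)
    {u₂ : EuclideanSpace ℝ (Fin 3)} (hu₂ : u₂ ∈ fccSlots)
    (hsteep₂ : ⟪A₂ u₂, EuclideanSpace.single (2 : Fin 3) (1 : ℝ)⟫_ℝ ≤ -(Real.sqrt 2 / 2)) :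
    ∃ C R₀ : ℝ, 1 ≤ R₀ ∧ ∀ h : ℝ, 0 ≤ h → ∀ ρ : ℝ, R₀ ≤ ρ →
      ∀ X P₁ P₂ : Finset (EuclideanSpace ℝ (Fin 3)),
      (∀ p ∈ X, ∀ q ∈ X, p ≠ q → 1 ≤ dist p q) → P₁ ⊆ X → P₂ ⊆ X \ P₁ →
      (∀ p ∈ X, -(2 * R₀) ≤ p 2 ∧ p 2 ≤ h + 2 * R₀ ∧ p 0 ^ 2 + p 1 ^ 2 ≤ ρ ^ 2) →
      (∀ p, p ∈ P₁ ↔ (p ∈ (fun q => A₁ q + t₁) '' fccStacking 1 (Real.sqrt (2 / 3)) ∧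
        -(2 * R₀) ≤ p 2 ∧ p 2 ≤ -R₀ ∧ p 0 ^ 2 + p 1 ^ 2 ≤ ρ ^ 2)) →
      (∀ p, p ∈ P₂ ↔ (p ∈ (fun q => A₂ q + t₂) '' fccStacking 1 (Real.sqrt (2 / 3)) ∧
        h + R₀ ≤ p 2 ∧ p 2 ≤ h + 2 * R₀ ∧ p 0 ^ 2 + p 1 ^ 2 ≤ ρ ^ 2)) →
      -- CLEAN outer slivers
      (∀ p ∈ X, p 2 < -(2 * R₀) + 1 → p ∈ (fun q => A₁ q + t₁) '' fccStacking 1 (Real.sqrt (2 / 3))) →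
      (∀ p ∈ X, h + 2 * R₀ - 1 < p 2 → p ∈ (fun q => A₂ q + t₂) '' fccStacking 1 (Real.sqrt (2 / 3))) →
      ((((P₁ ×ˢ (X \ P₁)).filter fun pq => dist pq.1 pq.2 = 1).card : ℕ) : ℝ) +
        ((((P₂ ×ˢ ((X \ P₁) \ P₂)).filter fun pq => dist pq.1 pq.2 = 1).card : ℕ) : ℝ) ≤
        contactDeficiency ((X \ P₁) \ P₂) +
          (Real.sqrt 2 / 4 * ∑ᶠ w ∈ {w ∈ fccStacking 1 (Real.sqrt (2 / 3)) | ‖w‖ = 1},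
              |⟪w, A₁.symm (EuclideanSpace.single (2 : Fin 3) (1 : ℝ))⟫_ℝ| +
            Real.sqrt 2 / 4 * ∑ᶠ w ∈ {w ∈ fccStacking 1 (Real.sqrt (2 / 3)) | ‖w‖ = 1},
              |⟪w, A₂.symm (EuclideanSpace.single (2 : Fin 3) (1 : ℝ))⟫_ℝ| - 1 / 3770) * Real.pi * ρ ^ 2 +
          (((((X.filter fun e => e - A₁ u₁ ∈ X ∧ (∀ w ∈ fccSlots, e - A₁ u₁ + A₁ w ∈ X) ∧
                ∃ v ∈ fccSlots, e + A₁ v ∉ X).filter fun e => ∃ n : EuclideanSpace ℝ (Fin 3), ‖n‖ = 1 ∧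
              (∀ w ∈ fccSlots, ⟪A₁ w, n⟫_ℝ = 0 ∨ ⟪A₁ w, n⟫_ℝ = Real.sqrt (2 / 3) ∨
                ⟪A₁ w, n⟫_ℝ = -Real.sqrt (2 / 3)) ∧
              ⟪A₁ u₁, n⟫_ℝ = Real.sqrt (2 / 3) ∧
              (∀ w ∈ fccSlots, ⟪A₁ w, n⟫_ℝ ≤ 0 → e + A₁ w ∈ X) ∧
              (∀ w ∈ fccSlots, 0 < ⟪A₁ w, n⟫_ℝ → e + A₁ w ∉ X ∧ e - A₁ w + (2 * ⟪A₁ w, n⟫_ℝ) • n ∈ X)).card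
              : ℕ) : ℝ) +
           ((((X.filter fun e => e - A₂ u₂ ∈ X ∧ (∀ w ∈ fccSlots, e - A₂ u₂ + A₂ w ∈ X) ∧
                ∃ v ∈ fccSlots, e + A₂ v ∉ X).filter fun e => ∃ n : EuclideanSpace ℝ (Fin 3), ‖n‖ = 1 ∧
              (∀ w ∈ fccSlots, ⟪A₂ w, n⟫_ℝ = 0 ∨ ⟪A₂ w, n⟫_ℝ = Real.sqrt (2 / 3) ∨
                ⟪A₂ w, n⟫_ℝ = -Real.sqrt (2 / 3)) ∧
              ⟪A₂ u₂, n⟫_ℝ = Real.sqrt (2 / 3) ∧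
              (∀ w ∈ fccSlots, ⟪A₂ w, n⟫_ℝ ≤ 0 → e + A₂ w ∈ X) ∧
              (∀ w ∈ fccSlots, 0 < ⟪A₂ w, n⟫_ℝ → e + A₂ w ∉ X ∧ e - A₂ w + (2 * ⟪A₂ w, n⟫_ℝ) • n ∈ X)).card
              : ℕ) : ℝ)) / 7540 +
          C * (1 + h) * ρ := by
  obtain ⟨C₁, hC₁⟩ := affineSampleDeficit_upper A₁ t₁ 10 (by norm_num)
  obtain ⟨C₂, hC₂⟩ := affineSampleDeficit_upper A₂ t₂ 10 (by norm_num)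
  refine ⟨(240 * Real.sqrt 2 * Real.pi + 3120 * (4 * 10 + 2)) / 2 + 1 + |C₁| + |C₂|, 10, by norm_num, ?_⟩
  intro h hh ρ hρ X P₁ P₂ hX hP₁X hP₂X hcell hP₁ hP₂ hclean₁ hclean₂
  set φ₁ : ℝ := Real.sqrt 2 / 4 * ∑ᶠ w ∈ {w ∈ fccStacking 1 (Real.sqrt (2 / 3)) | ‖w‖ = 1},
      |⟪w, A₁.symm (EuclideanSpace.single (2 : Fin 3) (1 : ℝ))⟫_ℝ| with hφ₁
  set φ₂ : ℝ := Real.sqrt 2 / 4 * ∑ᶠ w ∈ {w ∈ fccStacking 1 (Real.sqrt (2 / 3)) | ‖w‖ = 1},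
      |⟪w, A₂.symm (EuclideanSpace.single (2 : Fin 3) (1 : ℝ))⟫_ℝ| with hφ₂
  have hP₂X' : P₂ ⊆ X := hP₂X.trans Finset.sdiff_subset
  have hρ0 : (0 : ℝ) ≤ ρ := by linarith
  -- the ledger with payers
  have hled := ledger_ge_faces_add_payers A₁ t₁ A₂ t₂ X P₁ P₂ 10 h ρ le_rfl hh hρ hX hcell hP₁X hP₂X' hP₁ hP₂
    hclean₁ hclean₂ hA₁₂ hA₂₁ hu₁ hsteep₁ hu₂ hsteep₂
  rw [← finsum_unit_fcc_symm_eq_sum_slots A₁, ← finsum_unit_fcc_symm_eq_sum_slots A₂, ← hφ₁, ← hφ₂] at hled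
  -- sources and sinks for both grains
  have hP₁w : ∀ p, p ∈ P₁ ↔ (p ∈ (fun q => A₁ q + t₁) '' fccStacking 1 (Real.sqrt (2 / 3)) ∧
      (-(2 * 10)) ≤ p 2 ∧ p 2 ≤ (-(2 * 10)) + 10 ∧ p 0 ^ 2 + p 1 ^ 2 ≤ ρ ^ 2) := by
    intro p; rw [hP₁ p, show -(2 * 10) + (10 : ℝ) = -10 by ring]
  have hEX₁ := card_exits_ge_window A₁ t₁ X P₁ (-(2 * 10)) 10 ρ (by norm_num) hρ hP₁X hP₁w hu₁
  have hP₂w : ∀ p, p ∈ P₂ ↔ (p ∈ (fun q => A₂ q + t₂) '' fccStacking 1 (Real.sqrt (2 / 3)) ∧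
      (h + 10) ≤ p 2 ∧ p 2 ≤ (h + 10) + 10 ∧ p 0 ^ 2 + p 1 ^ 2 ≤ ρ ^ 2) := by
    intro p; rw [hP₂ p, show h + 10 + 10 = h + 2 * 10 by ring]
  have hEX₂ := card_exits_ge_window A₂ t₂ X P₂ (h + 10) 10 ρ (by norm_num) hρ hP₂X' hP₂w hu₂
  have hPAY₁ := card_exits_le hg hc hX A₁ hu₁
  have hPAY₂ := card_exits_le hg hc hX A₂ hu₂
  -- the two payer sets sit inside the common payer set of the ledger
  set PAY := X.filter fun y => (X.filter fun q => dist y q = 1).card ≠ 12 ∧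
    ((∃ e ∈ X, (e - A₁ u₁ ∈ X ∧ (∀ w ∈ fccSlots, e - A₁ u₁ + A₁ w ∈ X) ∧ ∃ v ∈ fccSlots, e + A₁ v ∉ X) ∧
        (y = e ∨ dist e y = 1 ∨ (∃ z ∈ X, dist e z = 1 ∧ dist z y = 1) ∨
          ∃ z ∈ X, ∃ z' ∈ X, dist e z = 1 ∧ dist z z' = 1 ∧ dist z' y = 1)) ∨
      (∃ e ∈ X, (e - A₂ u₂ ∈ X ∧ (∀ w ∈ fccSlots, e - A₂ u₂ + A₂ w ∈ X) ∧ ∃ v ∈ fccSlots, e + A₂ v ∉ X) ∧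
        (y = e ∨ dist e y = 1 ∨ (∃ z ∈ X, dist e z = 1 ∧ dist z y = 1) ∨
          ∃ z ∈ X, ∃ z' ∈ X, dist e z = 1 ∧ dist z z' = 1 ∧ dist z' y = 1))) with hPAY
  set U₁ := X.filter fun y => (X.filter fun q => dist y q = 1).card ≠ 12 ∧
    ∃ e ∈ X, (e - A₁ u₁ ∈ X ∧ (∀ w ∈ fccSlots, e - A₁ u₁ + A₁ w ∈ X) ∧ ∃ v ∈ fccSlots, e + A₁ v ∉ X) ∧
      (y = e ∨ dist e y = 1 ∨ (∃ z ∈ X, dist e z = 1 ∧ dist z y = 1) ∨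
        ∃ z ∈ X, ∃ z' ∈ X, dist e z = 1 ∧ dist z z' = 1 ∧ dist z' y = 1) with hU₁
  set U₂ := X.filter fun y => (X.filter fun q => dist y q = 1).card ≠ 12 ∧
    ∃ e ∈ X, (e - A₂ u₂ ∈ X ∧ (∀ w ∈ fccSlots, e - A₂ u₂ + A₂ w ∈ X) ∧ ∃ v ∈ fccSlots, e + A₂ v ∉ X) ∧
      (y = e ∨ dist e y = 1 ∨ (∃ z ∈ X, dist e z = 1 ∧ dist z y = 1) ∨
        ∃ z ∈ X, ∃ z' ∈ X, dist e z = 1 ∧ dist z z' = 1 ∧ dist z' y = 1) with hU₂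
  have hU₁P : U₁ ⊆ PAY := by
    intro y hy
    rw [hU₁, mem_filter] at hy
    rw [hPAY, mem_filter]
    exact ⟨hy.1, hy.2.1, Or.inl hy.2.2⟩
  have hU₂P : U₂ ⊆ PAY := by
    intro y hy
    rw [hU₂, mem_filter] at hy
    rw [hPAY, mem_filter]
    exact ⟨hy.1, hy.2.1, Or.inr hy.2.2⟩
  have hc₁ : (U₁.card : ℝ) ≤ PAY.card := Nat.cast_le.2 (card_le_card hU₁P)
  have hc₂ : (U₂.card : ℝ) ≤ PAY.card := Nat.cast_le.2 (card_le_card hU₂P)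
  have hPAY₁' := (Nat.cast_le (α := ℝ)).2 hPAY₁
  have hPAY₂' := (Nat.cast_le (α := ℝ)).2 hPAY₂
  push_cast at hPAY₁' hPAY₂'
  -- steep fluxes: `√2 |⟪A u, e₃⟫| ≥ 1`
  have hs2 : Real.sqrt 2 * (Real.sqrt 2 / 2) = 1 := by
    rw [← mul_div_assoc, Real.mul_self_sqrt (by norm_num)]; norm_num
  have hsq2pos : (0 : ℝ) < Real.sqrt 2 / 2 := by positivity
  have hf₁ : 1 ≤ Real.sqrt 2 * |⟪A₁ u₁, EuclideanSpace.single (2 : Fin 3) (1 : ℝ)⟫_ℝ| := by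
    have h1 : Real.sqrt 2 / 2 ≤ |⟪A₁ u₁, EuclideanSpace.single (2 : Fin 3) (1 : ℝ)⟫_ℝ| :=
      hsteep₁.trans (le_abs_self _)
    have := mul_le_mul_of_nonneg_left h1 (Real.sqrt_nonneg 2)
    rwa [hs2] at this
  have hf₂ : 1 ≤ Real.sqrt 2 * |⟪A₂ u₂, EuclideanSpace.single (2 : Fin 3) (1 : ℝ)⟫_ℝ| := by
    have h1 : Real.sqrt 2 / 2 ≤ |⟪A₂ u₂, EuclideanSpace.single (2 : Fin 3) (1 : ℝ)⟫_ℝ| := by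
      rw [abs_of_nonpos (by linarith only [hsteep₂, hsq2pos] : ⟪A₂ u₂, EuclideanSpace.single (2 : Fin 3) (1 : ℝ)⟫_ℝ ≤ 0)]
      linarith only [hsteep₂]
    have := mul_le_mul_of_nonneg_left h1 (Real.sqrt_nonneg 2)
    rwa [hs2] at this
  have hflux₁ : Real.pi * (ρ - 1) ^ 2 ≤
      Real.sqrt 2 * |⟪A₁ u₁, EuclideanSpace.single (2 : Fin 3) (1 : ℝ)⟫_ℝ| * Real.pi * (ρ - 1) ^ 2 := by
    have h0 : (0 : ℝ) ≤ Real.pi * (ρ - 1) ^ 2 := by positivity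
    nlinarith only [h0, hf₁]
  have hflux₂ : Real.pi * (ρ - 1) ^ 2 ≤
      Real.sqrt 2 * |⟪A₂ u₂, EuclideanSpace.single (2 : Fin 3) (1 : ℝ)⟫_ℝ| * Real.pi * (ρ - 1) ^ 2 := by
    have h0 : (0 : ℝ) ≤ Real.pi * (ρ - 1) ^ 2 := by positivity
    nlinarith only [h0, hf₂]
  -- the two upper slab counts and the two splits
  have hD₁ := hC₁ (-(2 * 10)) (-10) (by ring) ρ hρ P₁ hP₁
  have hD₂ := hC₂ (h + 10) (h + 2 * 10) (by ring) ρ hρ P₂ hP₂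
  have hsplit₁ := contactDeficiency_sdiff_split hP₁X
  have hsplit₂ := contactDeficiency_sdiff_split hP₂X
  have htwo := two_mul_contactDeficiency_eq_sum X
  -- constants
  have hb : C₁ * ρ ≤ |C₁| * (1 + h) * ρ := by
    have h1 : 0 ≤ (|C₁| - C₁) * ρ := mul_nonneg (by linarith only [le_abs_self C₁]) hρ0
    have h2 : 0 ≤ |C₁| * h * ρ := by positivity
    linarith only [h1, h2]
  have hc' : C₂ * ρ ≤ |C₂| * (1 + h) * ρ := by
    have h1 : 0 ≤ (|C₂| - C₂) * ρ := mul_nonneg (by linarith only [le_abs_self C₂]) hρ0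
    have h2 : 0 ≤ |C₂| * h * ρ := by positivity
    linarith only [h1, h2]
  have hπ : Real.pi ≤ 4 := Real.pi_le_four
  have hπ0 : 0 ≤ Real.pi := Real.pi_pos.le
  have hsq : 0 ≤ Real.sqrt 2 := Real.sqrt_nonneg 2
  have hs2' : Real.sqrt 2 ≤ 2 := by
    rw [show (2 : ℝ) = Real.sqrt (2 ^ 2) by rw [Real.sqrt_sq (by norm_num)]]
    exact Real.sqrt_le_sqrt (by norm_num)
  -- `π(ρ−1)² − 10√2π(ρ−1) ≥ πρ² − 100(1+h)ρ`
  have hπρ : Real.pi * ρ ≤ 4 * ρ := mul_le_mul_of_nonneg_right hπ hρ0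
  have hsπ : Real.sqrt 2 * Real.pi ≤ 8 := by nlinarith only [hπ, hπ0, hsq, hs2']
  have hsπρ : Real.sqrt 2 * Real.pi * ρ ≤ 8 * ρ := mul_le_mul_of_nonneg_right hsπ hρ0
  have hkey : Real.pi * ρ ^ 2 - 100 * (1 + h) * ρ ≤
      Real.pi * (ρ - 1) ^ 2 - 10 * Real.sqrt 2 * Real.pi * (ρ - 1) := by
    have e : Real.pi * (ρ - 1) ^ 2 - 10 * Real.sqrt 2 * Real.pi * (ρ - 1) - (Real.pi * ρ ^ 2 - 100 * (1 + h) * ρ)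
        = (100 * ρ - 2 * (Real.pi * ρ) - 10 * (Real.sqrt 2 * Real.pi * ρ)) + 100 * (h * ρ) + Real.pi +
          10 * (Real.sqrt 2 * Real.pi) := by ring
    have h1 : 0 ≤ h * ρ := mul_nonneg hh hρ0
    have h2 : 0 ≤ Real.sqrt 2 * Real.pi := mul_nonneg hsq hπ0
    linarith only [e, h1, h2, hπρ, hsπρ, hπ0, hρ0]
  have hhρ : 0 ≤ h * ρ := mul_nonneg hh hρ0
  have hTC₀ : (0 : ℝ) ≤ ρ ^ 2 := sq_nonneg ρ
  linarith only [hled, hEX₁, hEX₂, hPAY₁', hPAY₂', hc₁, hc₂, hflux₁, hflux₂, hD₁, hD₂, hsplit₁, hsplit₂, htwo, hb,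
    hc', hkey, hρ0, hh, hhρ, hπ0]

end Summit.Ventures.Crystal3D.Theorems

end
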